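import Summits.BirchSwinnertonDyer.BirchSwinnertonDyer.Theorems.SylvesterTwoHeegnerIndexTwoAdicPairValuation
import Summits.BirchSwinnertonDyer.BirchSwinnertonDyer.Theorems.SylvesterTwoHeegnerIndexTwoAdicPairEngine
import HarnessLib

/-!
# Route `SylvesterTwoHeegnerIndex` (rung K7t), item 19580 `TwoAdicPairHSY`: MODEL-LEVEL
# non-negativity and the two residue-class conclusions `ord₂ q = 2m`, `m ∈ ℕ` (the `θ`-free form,
# ready for Hu–Shu–Yin's display)

Cell `bsd-cm`, seat `bsd-cm-two` (prover-bsd-cm-two-g5-0; planner D104 (ii): NON-NEGATIVITY + ASSEMBLY).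
PARTITION (D55): CornerF at `p = 2` (B14/O12) × 𝒞_HSY × `p = 2` — types-the-object-of (kernel helper
`--supports stmt-BirchSwinnertonDyer-19580`); closes no cell and no item; BSD is not claimed.
Everything is PROVED (no named fact, no definition).

The currency is that of x1b GEN 48's parity engine `even_padicValRat_two_of_model`
(`…TwoAdicPairEngine.lean`): a model `B/ℚ` of `E_p` (`C • B = cubeSumCurve p`), a quadratic number
field `K ∋ ω`, a RATIONAL point `P₀ ∈ B(ℚ)` with `ι P₀ ∈ B(K)` of infinite order, `Y ∈ B(K)`, and a
rational `q ≠ 0` with `q·ĥ_K(ι P₀) = 2^i·ĥ_K(Y)` (Hu–Shu–Yin's display (bsd): `q = #Ш_an(E_p)·#Ш_an(E_{3p²})`,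
`P₀` their generator, `Y` their Heegner point, `i = 0 | −2`). The generator property is taken in the
`ι`-form «every `ι Q`, `Q ∈ B(ℚ)`, is `≡ m·ι P₀` modulo torsion».

* §1 `ne_two_smul_add_torsion_of_incl_generator` — such `ι P₀` is NOT in `2·B(K) + tors`
  (`B(K)[2] = 0` from x1b's `SylvesterTwoFrame.two_torsion_eq_zero_of_model_of_finrank_eq_two`, BY NAME;
  Galois descent `QuadraticDescent.exists_incl_eq_of_conjMap_eq`, `conjMap_incl`).
* §2 `le_padicValRat_two_of_model` — **`i ≤ ord₂ q`** (transport to the Mordell model,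
  x1b's `K`-line `exists_zsmul_eq_of_finrank_eq_two`, this seat's `2`-primitive descent), and
  `add_two_le_padicValRat_two_of_model_of_twoDivisible` — **`i + 2 ≤ ord₂ q`** when `Y ∈ 2·B(K) + tors`.
* §3 with x1b's parity: **`exists_nat_padicValRat_two_eq_of_model`** (`i = 0`: `ord₂ q = 2m`, `m ∈ ℕ`
  — the `p ≡ 4 (9)` layer of 19580, unconditional in the kernel) and
  **`exists_nat_padicValRat_two_eq_of_model_of_twoDivisible`** (`i = −2` under the displayed THEOREM C
  hypothesis «`Y ∈ 2·E_p(K) + tors`» — MEMO bsd-cm-two v2.6 §15.5, refereed, NOT in print — the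
  `p ≡ 7 (9)` layer).

What remains for 19580: feed Hu–Shu–Yin's display (x1b's cited fact, when it lands) into §3.

## References
* Y. Hu, J. Shu, H. Yin, Trans. AMS 372 (2019) = arXiv:1708.05266, pp. 8, 12.
* J. H. Silverman, *The Arithmetic of Elliptic Curves*, GTM 106, VIII.9.1, X.1.
* MEMO bsd-cm-two v2.6 §15.
-/

set_option autoImplicit false
-- the Summit-side namespace `Summit.BirchSwinnertonDyer.BirchSwinnertonDyer.…` (summit = problem) is mandated by D-0017
set_option linter.dupNamespace false

noncomputable section

open scoped Classical

open WeierstrassCurve WeierstrassCurve.Affine WeierstrassCurve.Affine.Point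
  Summit.BirchSwinnertonDyer.BirchSwinnertonDyer.Theorems.SylvesterTwoCMNormForm
  Literature.NumberTheory.EllipticCurves.HuShuYin2019

namespace Summit.BirchSwinnertonDyer.BirchSwinnertonDyer.Theorems.SylvesterTwoNonneg

/-! ## §1 `ι P₀ ∉ 2·B(K) + tors` for a rational generator (`ι`-currency) -/

section InclGenerator

variable {W₀ : WeierstrassCurve ℚ} {K : Type} [Field K] [NumberField K]

/-- **A rational generator is not halvable over a quadratic field without `2`-torsion
(`ι`-currency).** `W = W₀ ⊗ K`, `K/ℚ` quadratic, `W(K)[2] = 0`; `P₀ ∈ W₀(ℚ)` with `ι P₀` of infinite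
order and every `ι Q` (`Q ∈ W₀(ℚ)`) congruent to an integer multiple of `ι P₀` modulo torsion. Then
`ι P₀ ≠ 2·Z + T` (`T` torsion): torsion is odd (`exists_torsion_eq_two_smul`), so `ι P₀ = 2Q`; the
conjugation `σ` fixes `ι P₀` (`conjMap_incl`), so `2(σQ − Q) = 0`, `σQ = Q`, `Q = ι Q₀`
(`exists_incl_eq_of_conjMap_eq`), and `(1 − 2m)·ι P₀` would be torsion. Silverman *AEC* X.1.
[cite: SilvermanAEC2009, X.1] -/
theorem ne_two_smul_add_torsion_of_incl_generator (h2K : Module.finrank ℚ K = 2)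
    (hE2 : ∀ Q : (W₀.baseChange K).toAffine.Point, (2 : ℤ) • Q = 0 → Q = 0)
    (P₀ : W₀.toAffine.Point) (hPinf : ¬ IsOfFinAddOrder (QuadraticDescent.incl K W₀ P₀))
    (hgen : ∀ Q : W₀.toAffine.Point, ∃ m : ℤ,
      IsOfFinAddOrder (QuadraticDescent.incl K W₀ Q - m • QuadraticDescent.incl K W₀ P₀)) :
    ∀ Z T : (W₀.baseChange K).toAffine.Point, IsOfFinAddOrder T →
      QuadraticDescent.incl K W₀ P₀ ≠ (2 : ℤ) • Z + T := by
  obtain ⟨t, c, ht, htc⟩ :=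
    Literature.NumberTheory.QuadraticFields.Quadratic.exists_sq_eq_algebraMap (F := ℚ) (K := K) h2K
  have hσ : Literature.NumberTheory.QuadraticFields.Quadratic.conj h2K ht htc ≠ AlgHom.id ℚ K := by
    intro h
    have hgen' := Literature.NumberTheory.QuadraticFields.Quadratic.conj_gen h2K ht htc
    rw [h, AlgHom.id_apply] at hgen'
    have ht0 : t = 0 := by linear_combination hgen' / 2
    exact ht ⟨0, by rw [_root_.map_zero, ht0]⟩
  have hhalf : ∀ Q : (W₀.baseChange K).toAffine.Point,
      QuadraticDescent.incl K W₀ P₀ ≠ (2 : ℤ) • Q := by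
    intro Q hPQ
    set σ := Literature.NumberTheory.QuadraticFields.Quadratic.conj h2K ht htc with hσdef
    have hσP : QuadraticDescent.conjMap W₀ σ (QuadraticDescent.incl K W₀ P₀) =
        QuadraticDescent.incl K W₀ P₀ := QuadraticDescent.conjMap_incl W₀ σ P₀
    have h2d : (2 : ℤ) • (QuadraticDescent.conjMap W₀ σ Q - Q) = 0 := by
      rw [smul_sub, ← map_zsmul, ← hPQ, hσP, sub_self]
    have hfix : QuadraticDescent.conjMap W₀ σ Q = Q := sub_eq_zero.mp (hE2 _ h2d)
    obtain ⟨Q₀, hQ₀⟩ := QuadraticDescent.exists_incl_eq_of_conjMap_eq h2K W₀ hσ hfix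
    obtain ⟨m, hm⟩ := hgen Q₀
    rw [hQ₀] at hm
    have e : (1 - 2 * m) • QuadraticDescent.incl K W₀ P₀ =
        (2 : ℤ) • (Q - m • QuadraticDescent.incl K W₀ P₀) := by
      rw [smul_sub, ← hPQ, sub_smul, one_smul, mul_smul]
    refine hPinf (Literature.NumberTheory.EllipticCurves.isOfFinAddOrder_of_zsmul
      (n := 1 - 2 * m) (by omega) ?_)
    rw [e]
    exact hm.zsmul
  intro Z T hT hPZ
  obtain ⟨T₁, -, rfl⟩ := exists_torsion_eq_two_smul hE2 hT
  exact hhalf (Z + T₁) (by rw [hPZ, smul_add])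

/-- Non-halvability is transported by an additive isomorphism. [folklore] -/
theorem ne_two_smul_add_torsion_map {A A' : Type*} [AddCommGroup A] [AddCommGroup A'] (φ : A ≃+ A')
    {P : A} (hP : ∀ Z T : A, IsOfFinAddOrder T → P ≠ (2 : ℤ) • Z + T) :
    ∀ Z T : A', IsOfFinAddOrder T → φ P ≠ (2 : ℤ) • Z + T := by
  intro Z T hT h
  apply hP (φ.symm Z) (φ.symm T) ((φ.symm : A' ≃+ A).toAddMonoidHom.isOfFinAddOrder hT)
  apply φ.injective
  rw [map_add, map_zsmul, φ.apply_symm_apply, φ.apply_symm_apply]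
  exact h

end InclGenerator

/-! ## §2 `i ≤ ord₂ q` (and `i + 2 ≤ ord₂ q` under `2`-divisibility) on a model of `E_p` -/

section Model

variable {K : Type} [Field K] [NumberField K] {ω : K}

/-- **MODEL-LEVEL NON-NEGATIVITY: `i ≤ ord₂ q`.** `K/ℚ` quadratic with `ω ∈ K` (`ω² + ω + 1 = 0`),
`B/ℚ` a model of `E_p` (`C • B = cubeSumCurve p`, `p` an odd prime) with `rank_ℤ B(K) = 2`, `P₀ ∈ B(ℚ)`
a generator modulo torsion in `ι`-form with `ι P₀` of infinite order, `Y ∈ B(K)`, and a rational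
`q ≠ 0` with `q·ĥ_K(ι P₀) = 2^i·ĥ_K(Y)`. Then `i ≤ ord₂ q`: on the Mordell model `Y = ((a + bω)/n) ⊗ P`,
`q = 2^i·(a² − ab + b²)/n²` and the coordinate is `2`-integral because `P` is not halvable.
[cite: HuShuYin2019, pp. 8, 12] -/
theorem le_padicValRat_two_of_model (hω : ω ^ 2 + ω + 1 = 0) (h2K : Module.finrank ℚ K = 2)
    {p : ℕ} (hp : p.Prime) (hp2 : p ≠ 2) (B : WeierstrassCurve ℚ) [B.IsElliptic]
    (C : VariableChange ℚ) (hC : C • B = cubeSumCurve (p : ℚ))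
    (hrank : (B.baseChange K).mordellWeilRank = 2) (P₀ : B.toAffine.Point)
    (hP : ¬ IsOfFinAddOrder (QuadraticDescent.incl K B P₀))
    (hgen : ∀ Q : B.toAffine.Point, ∃ m : ℤ,
      IsOfFinAddOrder (QuadraticDescent.incl K B Q - m • QuadraticDescent.incl K B P₀))
    (Y : (B.baseChange K).toAffine.Point) {q : ℚ} (hq : q ≠ 0) {i : ℤ}
    (hid : (q : ℝ) * canonicalHeight (QuadraticDescent.incl K B P₀) = (2 : ℝ) ^ i * canonicalHeight Y) :
    i ≤ padicValRat 2 q := by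
  -- Hu–Shu–Yin's model over `K` (as in x1b's engine)
  have hCK : (C • B).baseChange K = (cubeSumCurve (p : ℚ)).baseChange K := by rw [hC]
  obtain ⟨ha1, ha2, ha3, ha4⟩ := cubeSumCurve_baseChange_mordell (K := K) (p : ℚ)
  haveI hBK : (B.baseChange K).IsElliptic := inferInstanceAs (B.map (algebraMap ℚ K)).IsElliptic
  haveI hE : (cubeSumCurve (p : ℚ)).IsElliptic := hC ▸ (inferInstance : (C • B).IsElliptic)
  haveI hEK : ((cubeSumCurve (p : ℚ)).baseChange K).IsElliptic :=
    inferInstanceAs ((cubeSumCurve (p : ℚ)).map (algebraMap ℚ K)).IsElliptic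
  let φ : (B.baseChange K).toAffine.Point ≃+ ((cubeSumCurve (p : ℚ)).baseChange K).toAffine.Point :=
    (VariableChange.pointEquivBaseChange B C K).trans (Affine.Point.congrEquiv hCK)
  have hφ : ∀ X, canonicalHeight (φ X) = canonicalHeight X := fun X => by
    show canonicalHeight (Affine.Point.congrEquiv hCK (VariableChange.pointEquivBaseChange B C K X)) =
      canonicalHeight X
    rw [SylvesterTwoCMNormForm.canonicalHeight_congrEquiv, canonicalHeight_pointEquivBaseChange]
  obtain ⟨θ, hθ⟩ := exists_omegaRot (W := (cubeSumCurve (p : ℚ)).baseChange K) hω ha1 ha2 ha3 ha4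
  have hθ0 : (θ : _ → _) 0 = 0 := map_zero θ
  have hP' : ¬IsOfFinAddOrder (φ (QuadraticDescent.incl K B P₀)) := fun h =>
    hP ((φ.injective.isOfFinAddOrder_iff (f := φ.toAddMonoidHom)).mp h)
  have hr : Module.finrank ℤ ((cubeSumCurve (p : ℚ)).baseChange K).toAffine.Point = 2 := by
    rw [← φ.toIntLinearEquiv.finrank_eq]; exact hrank
  obtain ⟨n, a, b, hn, hY'⟩ :=
    exists_zsmul_eq_of_finrank_eq_two hω ha1 ha2 ha3 ha4 hθ0 hθ hr hP' (φ Y)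
  have hid' : (q : ℝ) * canonicalHeight (φ (QuadraticDescent.incl K B P₀)) =
      (2 : ℝ) ^ i * canonicalHeight (φ Y) := by rw [hφ, hφ]; exact hid
  -- exact valuation and `2`-integrality of the coordinate
  have hval := padicValRat_two_of_height_identity hω ha1 ha2 ha3 ha4 hθ0 hθ hP'
    IsOfFinAddOrder.zero hn hY' hq hid'
  have hE2 : ∀ Q : (B.baseChange K).toAffine.Point, (2 : ℤ) • Q = 0 → Q = 0 := fun Q h2 =>
    SylvesterTwoFrame.two_torsion_eq_zero_of_model_of_finrank_eq_two K h2K hp hp2 B ⟨C, hC⟩ Q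
      (by rw [two_nsmul]; rwa [two_zsmul] at h2)
  have hnh := ne_two_smul_add_torsion_map φ
    (ne_two_smul_add_torsion_of_incl_generator h2K hE2 P₀ hP hgen)
  have h0 := padicValRat_two_norm_div_sq_nonneg hω ha1 ha2 ha3 ha4 hθ0 hθ (omega_ne_one hω) hnh
    n.natAbs le_rfl hn IsOfFinAddOrder.zero hY'
  rw [hval]; linarith

/-- **`i + 2 ≤ ord₂ q` when `Y` is `2`-divisible modulo torsion** (same setting; the hypothesis
`Y = 2·Y′ + T′` is, for Hu–Shu–Yin's point and `p ≡ 7 (9)`, MEMO bsd-cm-two THEOREM C — displayed,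
NOT in print). [cite: HuShuYin2019, pp. 8, 12] -/
theorem add_two_le_padicValRat_two_of_model_of_twoDivisible (hω : ω ^ 2 + ω + 1 = 0)
    (h2K : Module.finrank ℚ K = 2) {p : ℕ} (hp : p.Prime) (hp2 : p ≠ 2) (B : WeierstrassCurve ℚ)
    [B.IsElliptic] (C : VariableChange ℚ) (hC : C • B = cubeSumCurve (p : ℚ))
    (hrank : (B.baseChange K).mordellWeilRank = 2) (P₀ : B.toAffine.Point)
    (hP : ¬ IsOfFinAddOrder (QuadraticDescent.incl K B P₀))
    (hgen : ∀ Q : B.toAffine.Point, ∃ m : ℤ,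
      IsOfFinAddOrder (QuadraticDescent.incl K B Q - m • QuadraticDescent.incl K B P₀))
    (Y : (B.baseChange K).toAffine.Point) {q : ℚ} (hq : q ≠ 0) {i : ℤ}
    (hid : (q : ℝ) * canonicalHeight (QuadraticDescent.incl K B P₀) = (2 : ℝ) ^ i * canonicalHeight Y)
    (hC2 : ∃ Y' T' : (B.baseChange K).toAffine.Point, IsOfFinAddOrder T' ∧ Y = (2 : ℤ) • Y' + T') :
    i + 2 ≤ padicValRat 2 q := by
  obtain ⟨Y', T', hT', rfl⟩ := hC2
  haveI hBK : (B.baseChange K).IsElliptic := inferInstanceAs (B.map (algebraMap ℚ K)).IsElliptic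
  -- `q·ĥ(ι P₀) = 2^(i+2)·ĥ(Y')`
  have hid' : (q : ℝ) * canonicalHeight (QuadraticDescent.incl K B P₀) =
      (2 : ℝ) ^ (i + 2) * canonicalHeight Y' := by
    rw [hid, canonicalHeight_add_of_isOfFinAddOrder _ T' hT', canonicalHeight_zsmul_holds, zpow_add₀
      (two_ne_zero)]
    push_cast
    ring
  have h := le_padicValRat_two_of_model hω h2K hp hp2 B C hC hrank P₀ hP hgen Y' hq hid'
  linarith

end Model

/-! ## §3 `ord₂ q = 2m`, `m ∈ ℕ`: parity (x1b) ∧ non-negativity -/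

section Conclusion

variable {K : Type} [Field K] [NumberField K] {ω : K}

/-- **The `p ≡ 4 (mod 9)` layer of `TwoAdicPairHSY` (i = 0), model level.** `K/ℚ` quadratic with
`ω ∈ K`, `B` a model of `E_p` (`p` odd prime) with `rank_ℤ B(K) = 2`, `P₀ ∈ B(ℚ)` a generator modulo
torsion (`ι`-form) of infinite order in `B(K)`, `Y ∈ B(K)`, `q ≠ 0` rational with `q·ĥ_K(ι P₀) = ĥ_K(Y)`.
Then `ord₂ q = 2m` with `m ∈ ℕ`: EVEN by x1b's `even_padicValRat_two_of_model` (`2` inert in `ℤ[ω]`)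
and `≥ 0` by `le_padicValRat_two_of_model` (the generator is not halvable). With Hu–Shu–Yin's display
(bsd) (`q = #Ш_an(E_p)·#Ш_an(E_{3p²})`, `P₀`, `Y` theirs) this IS the crux for `p ≡ 4 (9)`.
[cite: HuShuYin2019, pp. 8, 12] -/
theorem exists_nat_padicValRat_two_eq_of_model (hω : ω ^ 2 + ω + 1 = 0)
    (h2K : Module.finrank ℚ K = 2) {p : ℕ} (hp : p.Prime) (hp2 : p ≠ 2) (B : WeierstrassCurve ℚ)
    [B.IsElliptic] (C : VariableChange ℚ) (hC : C • B = cubeSumCurve (p : ℚ))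
    (hrank : (B.baseChange K).mordellWeilRank = 2) (P₀ : B.toAffine.Point)
    (hP : ¬ IsOfFinAddOrder (QuadraticDescent.incl K B P₀))
    (hgen : ∀ Q : B.toAffine.Point, ∃ m : ℤ,
      IsOfFinAddOrder (QuadraticDescent.incl K B Q - m • QuadraticDescent.incl K B P₀))
    (Y : (B.baseChange K).toAffine.Point) {q : ℚ} (hq : q ≠ 0)
    (hid : (q : ℝ) * canonicalHeight (QuadraticDescent.incl K B P₀) = canonicalHeight Y) :
    ∃ m : ℕ, padicValRat 2 q = 2 * m := by
  have hid' : (q : ℝ) * canonicalHeight (QuadraticDescent.incl K B P₀) =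
      (2 : ℝ) ^ (0 : ℤ) * canonicalHeight Y := by rw [hid, zpow_zero, one_mul]
  have hpar := even_padicValRat_two_of_model hω B C hC hrank hP Y hq (i := 0) ⟨0, rfl⟩ hid'
  have h0 := le_padicValRat_two_of_model hω h2K hp hp2 B C hC hrank P₀ hP hgen Y hq hid'
  exact exists_nat_eq_two_mul_of_even_of_nonneg hpar h0

/-- **The `p ≡ 7 (mod 9)` layer of `TwoAdicPairHSY` (i = −2), model level, modulo THEOREM C.** Same
setting with `q·ĥ_K(ι P₀) = 2^{−2}·ĥ_K(Y)` and the DISPLAYED hypothesis `Y ∈ 2·B(K) + tors` (for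
Hu–Shu–Yin's point: MEMO bsd-cm-two v2.6 §15.5 THEOREM C, refereed, NOT in print, never a Literature
fact). Then `ord₂ q = 2m`, `m ∈ ℕ`. [cite: HuShuYin2019, pp. 8, 12] -/
theorem exists_nat_padicValRat_two_eq_of_model_of_twoDivisible (hω : ω ^ 2 + ω + 1 = 0)
    (h2K : Module.finrank ℚ K = 2) {p : ℕ} (hp : p.Prime) (hp2 : p ≠ 2) (B : WeierstrassCurve ℚ)
    [B.IsElliptic] (C : VariableChange ℚ) (hC : C • B = cubeSumCurve (p : ℚ))
    (hrank : (B.baseChange K).mordellWeilRank = 2) (P₀ : B.toAffine.Point)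
    (hP : ¬ IsOfFinAddOrder (QuadraticDescent.incl K B P₀))
    (hgen : ∀ Q : B.toAffine.Point, ∃ m : ℤ,
      IsOfFinAddOrder (QuadraticDescent.incl K B Q - m • QuadraticDescent.incl K B P₀))
    (Y : (B.baseChange K).toAffine.Point) {q : ℚ} (hq : q ≠ 0)
    (hid : (q : ℝ) * canonicalHeight (QuadraticDescent.incl K B P₀) =
      (2 : ℝ) ^ (-2 : ℤ) * canonicalHeight Y)
    (hC2 : ∃ Y' T' : (B.baseChange K).toAffine.Point, IsOfFinAddOrder T' ∧ Y = (2 : ℤ) • Y' + T') :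
    ∃ m : ℕ, padicValRat 2 q = 2 * m := by
  have hpar := even_padicValRat_two_of_model hω B C hC hrank hP Y hq (i := -2) ⟨-1, rfl⟩ hid
  have h0 := add_two_le_padicValRat_two_of_model_of_twoDivisible hω h2K hp hp2 B C hC hrank P₀ hP
    hgen Y hq hid hC2
  exact exists_nat_eq_two_mul_of_even_of_nonneg hpar (by linarith)

end Conclusion

end Summit.BirchSwinnertonDyer.BirchSwinnertonDyer.Theorems.SylvesterTwoNonneg

end
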